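import Mathlib.FieldTheory.IsAlgClosed.AlgebraicClosure
import Literature.IUT.HodgeTheaters.KappaCoricGalois
import HarnessLib

/-!
# GapSizingBSketch — SIGNATURES ONLY for GAP-SIZING-B (G-L5t9g8-1), abc-iut-inv-2 g1 cycle 4

Defs / `Prop` statements / one data `structure`; no theorem, no placeholder proof term, no instance, no notation.
Nothing here is proposed to the tree; it pins the exact shapes of deliverables D1 / D3 / D5 of
`GAP-SIZING-B.md` and types risk locus R1.  Honesty: a typed statement is not a proof; no side
taken on [IUTchIII] Cor 3.12; no abc claim; `ThetaPartII` untouched.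
-/

set_option linter.dupNamespace false

namespace Summit.ABC.ABC.Cruxes.ThetaPartII.GapSizingB

open Literature.IUT.HodgeTheaters

universe u

/-- D1 (global/local alike): `Λ_L :=` an algebraic closure of `L(t)` — the model field on which
`π₁^{rat}` acts (L = F_mod globally, L = K_v locally). -/
abbrev RatAlgClosure (L : Type u) [Field L] : Type u := AlgebraicClosure (RatFunc L)

/-- D1: `G_L^{rat} := Gal(Λ_L / L(t))` — the arithmetic function-field MODEL of `π₁^{rat}(†𝒟^⊛)`
(resp. `π₁^{rat}(‡𝒟_v)`). -/
abbrev RatGal (L : Type u) [Field L] : Type u := RatAlgClosure L ≃ₐ[RatFunc L] RatAlgClosure L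

/-- D1: the `∞κ`-coric subset of a field `Λ ⊇ Ω(t)` cut out by L5-t2's `IsInftyKappaCoricIn`
(carrier of `†𝕄^⊛_{∞κ}` at the model; `Ω` = the field over which divisors are COUNTED — see R1). -/
def infKappaCoricSetIn {Ω : Type u} [Field Ω] [CharZero Ω] (S : CriticalLocus Ω)
    (Λ : Type u) [Field Λ] [Algebra (RatFunc Ω) Λ] : Set Λ :=
  {x | S.IsInftyKappaCoricIn Λ x}

/-- D1 law shape (t1 `CoricPair`-style stability): the model Galois group preserves the coric set. -/
def InfKappaCoricSetGalStable (L : Type u) [Field L] [CharZero L] (S : CriticalLocus L) : Prop :=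
  ∀ σ : RatGal L, ∀ x ∈ infKappaCoricSetIn S (RatAlgClosure L), σ x ∈ infKappaCoricSetIn S (RatAlgClosure L)

/-- R4/R1 plumbing: transport of the strictly critical locus along an (injective) field hom. -/
noncomputable def critMap {L L' : Type u} [Field L] [Field L'] (S : CriticalLocus L)
    (φ : L →+* L') : CriticalLocus L' :=
  ⟨S.pts.map ⟨φ, φ.injective⟩, by rw [Finset.card_map]; exact S.card_eq⟩

/-- D3 data shape: a base-change square `L(t) → L'(t)`, `Λ → Λ'` over `φ : L → L'`
(intended: `L = F_mod`, `L' = K_v`, `ι = resKummer` on carriers). -/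
structure BaseChangeSquare (L L' Λ Λ' : Type u) [Field L] [Field L'] [Field Λ] [Field Λ']
    [Algebra (RatFunc L) Λ] [Algebra (RatFunc L') Λ'] where
  /-- the base field map `F_mod → K_v` -/
  φ : L →+* L'
  /-- its extension to rational functions -/
  ψ : RatFunc L →+* RatFunc L'
  /-- `ψ` acts as `φ` on constants … -/
  ψ_C : ∀ c, ψ (RatFunc.C c) = RatFunc.C (φ c)
  /-- … and fixes the coordinate `t` -/
  ψ_X : ψ RatFunc.X = RatFunc.X
  /-- the restriction map on carriers (`resKummer`) -/
  ι : Λ →+* Λ'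
  /-- compatibility of `ι` with `ψ` -/
  ι_comm : ∀ g, ι (algebraMap (RatFunc L) Λ g) = algebraMap (RatFunc L') Λ' (ψ g)

/-- D5 clause (a), NAIVE typing («restriction lands in `‡𝕄_{∞κv}`») with divisors counted over the
base fields `L`, `L'` themselves.  RISK LOCUS R1: EXPECTED FALSE as typed, because
`CriticalLocus.poles f := f.denom.roots.toFinset` counts poles IN the base field and base change can
add rational poles («precisely one pole» is not base-change stable). -/
def ClauseANaive {L L' Λ Λ' : Type u} [Field L] [Field L'] [CharZero L] [CharZero L'] [Field Λ]
    [Field Λ'] [Algebra (RatFunc L) Λ] [Algebra (RatFunc L') Λ'] (S : CriticalLocus L)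
    (B : BaseChangeSquare L L' Λ Λ') : Prop :=
  ∀ x ∈ infKappaCoricSetIn S Λ, B.ι x ∈ infKappaCoricSetIn (critMap S B.φ) Λ'

/-- D5 clause (a), REPAIRED typing: the same statement with divisors counted over ALGEBRAICALLY
CLOSED `Ω ↪ Ω'` (geometric divisors; intended `Ω = F̄`, `Ω' =` an algebraic closure of `K_v`),
which is the base-change-stable reading of [IUTchI] Rmk 3.1.7 (i). -/
def ClauseAGeom {Ω Ω' Λ Λ' : Type u} [Field Ω] [Field Ω'] [CharZero Ω] [CharZero Ω']
    [IsAlgClosed Ω] [IsAlgClosed Ω'] [Field Λ] [Field Λ'] [Algebra (RatFunc Ω) Λ]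
    [Algebra (RatFunc Ω') Λ'] (S : CriticalLocus Ω) (B : BaseChangeSquare Ω Ω' Λ Λ') : Prop :=
  ∀ x ∈ infKappaCoricSetIn S Λ, B.ι x ∈ infKappaCoricSetIn (critMap S B.φ) Λ'

/-- D3/D5 clauses (b)(c) shape: `ι` (= `resKummer`) is equivariant along `ρ` (= `ratHom`) on the
coric set `M`. -/
def ClauseBC {G G' Λ Λ' : Type u} [Group G] [Group G'] [MulAction G Λ] [MulAction G' Λ']
    (ρ : G' →* G) (ι : Λ → Λ') (M : Set Λ) : Prop :=
  ∀ σ' : G', ∀ x ∈ M, ι (ρ σ' • x) = σ' • ι x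

/-- D3, R2: the restriction `ratHom : G' → G` must be continuous for the Krull topologies (Mathlib's
`InfiniteGalois.restrictNormalHom_continuous` covers algebraic towers only; `Λ_{K_v} / F_mod(t)` is
transcendental). -/
def RatHomContinuous {G G' : Type u} [TopologicalSpace G] [TopologicalSpace G'] (ρ : G' → G) : Prop :=
  Continuous ρ

end Summit.ABC.ABC.Cruxes.ThetaPartII.GapSizingB
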